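import Literature.Geometry.Riemannian.HarmonicMapTensionField
import Literature.Geometry.Riemannian.ExpMapJacobiField
import Literature.Geometry.Riemannian.ExpMapEnergyTaylor
import Literature.Geometry.Lorentzian.HypersurfaceRestriction
import HarnessLib

/-!
# Second variation of the energy, I: pointwise identities along a deformation
(topic `Geometry/Riemannian`)

The second-variation formula for the energy of maps (Eells–Sampson 1964, §3; Eells–Lemaire
1983, §3; for curves O'Neill 1983, Ch. 10, Thm. 10.4 / Synge's formula) rests on one
commutation: along a `C^∞` deformation `F : ℝ × M → N` with variation field `V = ∂ₜF`,
acceleration `a = D_t ∂ₜF` and a tangent vector `v ∈ T_x M`,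
`D_t D_t (dF_t v) = D_v a + R(V, dF v) V` (O'Neill 1983, Ch. 4, Prop. 44 (2):
`Z_{ts} − Z_{st} = R(x_t, x_s) Z`, the tree's
`covariantDerivAlong_covariantDerivAlong_sub_eq_curvature`, `TwoParameterCurvature.lean`).
With the first-variation machinery of `EnergyFirstVariation.lean` we PROVE, for a `C^∞` metric
`h` on `N` with its Levi-Civita connection (source modelled on a boundaryless model):

* `exists_contMDiff_curve_eventuallyEq_curveThrough` — a globally `C^∞` curve through `(x, v)`
  agreeing near `0` with the chart-straight curve (clamped reparametrisation,
  `exists_time_clamp`), so that the two-parameter tools apply globally;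
* `covariantDerivAlong_covariantDerivAlong_mfderiv_stage` — **`D_tD_t(dF_t v) = D_v a + R(V, dF v)V`**;
* `contMDiff_lift_mfderiv_stage`, `contMDiff_lift_covariantDerivAlong_mfderiv_stage` — the
  lifts `t ↦ (F t x, dF_t v)`, `t ↦ (F t x, D_t dF_t v)` to `TN` are `C^∞`;
* `hasDerivAt_deriv_val_mfderiv_stage` — **the second time-derivative of `h(dF_t v, dF_t w)`**:
  `h(D_v a + R(V, dF v)V, dF w) + 2 h(D_v V, D_w V) + h(dF v, D_w a + R(V, dF w)V)`;
* `hasDerivAt_deriv_energyDensity_stage` — **the second time-derivative of the energy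
  density** `d²/dt² e(F_t)(x) = ½ ∑ᵢⱼ (𝒢⁻¹)ⱼᵢ (…)` in the canonical frame.

Part II (integration over a closed source: `E″(t₀) = ∫ (|∇V|² + ∑ (𝒢⁻¹)ₖₗ h(R(V, dF sₖ)V, dF sₗ)) dμ_g
− ∫ h(a, τ(F_{t₀})) dμ_g`, and `E″(0) ≥ 0` at harmonic maps into targets of nonpositive
curvature) is the sequel. Everything here is proved; there are no definitions and no named facts.

## References

* B. O'Neill, *Semi-Riemannian Geometry* (1983), Ch. 4, pp. 122–123 and Prop. 44; Ch. 10,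
  Thm. 10.4. [ONeill1983]
* J. Eells, J. H. Sampson, *Harmonic mappings of Riemannian manifolds*, Amer. J. Math. 86 (1964),
  §3. [EellsSampson1964]
* J. Eells, A. Ratto, *Harmonic Maps and Minimal Immersions with Symmetries* (1993), Ch. I (1.9).
  [EellsRatto1993]
-/

noncomputable section

open Bundle Set Function Filter
open scoped Manifold ContDiff Topology

namespace Literature.Geometry.Riemannian

open Lorentzian Lorentzian.PseudoRiemannianMetric

namespace HarmonicMap

variable {EM : Type*} [NormedAddCommGroup EM] [NormedSpace ℝ EM] [FiniteDimensional ℝ EM]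
  {HM : Type*} [TopologicalSpace HM] {IM : ModelWithCorners ℝ EM HM} [IM.Boundaryless]
  {M : Type*} [TopologicalSpace M] [ChartedSpace HM M] [IsManifold IM ∞ M]
  {EN : Type*} [NormedAddCommGroup EN] [NormedSpace ℝ EN] [FiniteDimensional ℝ EN]
  [CompleteSpace EN] {HN : Type*} [TopologicalSpace HN] {IN : ModelWithCorners ℝ EN HN}
  {N : Type*} [TopologicalSpace N] [ChartedSpace HN N] [IsManifold IN ∞ N]

/-! ### A globally smooth curve through a tangent vector -/

omit [FiniteDimensional ℝ EM] in
/-- **A globally `C^∞` curve with prescribed initial vector**, agreeing near `0` with the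
chart-straight curve `curveThrough IM x v` (which is smooth only while the chart line stays in
the chart target): reparametrise the chart line by a smooth clamp `θ` (`exists_time_clamp`) of
small amplitude with `θ = id` near `0`. [folklore] -/
theorem exists_contMDiff_curve_eventuallyEq_curveThrough (x : M) (v : TangentSpace IM x) :
    ∃ γ : ℝ → M, ContMDiff 𝓘(ℝ, ℝ) IM ∞ γ ∧ γ =ᶠ[𝓝 0] curveThrough IM x v := by
  -- the set of parameters for which the chart line stays in the target is an open neighbourhood of `0`
  set ℓ : ℝ → EM := fun s ↦ extChartAt IM x x + s • (show EM from v) with hℓ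
  have hℓc : Continuous ℓ := continuous_const.add (continuous_id.smul continuous_const)
  have hS : ℓ ⁻¹' (extChartAt IM x).target ∈ 𝓝 (0 : ℝ) := by
    refine hℓc.continuousAt.preimage_mem_nhds ((isOpen_extChartAt_target x).mem_nhds ?_)
    simp only [hℓ, zero_smul, add_zero]
    exact mem_extChartAt_target x
  obtain ⟨ε, hε, hball⟩ := Metric.mem_nhds_iff.1 hS
  obtain ⟨θ, hθs, hθb, hθ0⟩ := exists_time_clamp (δ := ε / 2) (by positivity)
  have hθmem : ∀ s, ℓ (θ s) ∈ (extChartAt IM x).target := fun s ↦ hball (by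
    rw [Metric.mem_ball, Real.dist_eq, sub_zero]
    exact lt_of_le_of_lt (hθb s) (by linarith))
  refine ⟨fun s ↦ curveThrough IM x v (θ s), fun s ↦ ?_, ?_⟩
  · exact (contMDiffAt_curveThrough (n := ∞) x v (hθmem s)).comp s (hθs.contMDiff s)
  · filter_upwards [hθ0] with s hs
    simp only [hs, id]

/-! ### The two-parameter map `(t, s) ↦ F t (γ s)` and its `t`-velocity field -/

variable (h : PseudoRiemannianMetric IN ∞ EN (TangentSpace IN : N → Type _)) [h.HasLeviCivita]
  {F : ℝ → M → N} (hF : ContMDiff (𝓘(ℝ, ℝ).prod IM) IN ∞ (fun p : ℝ × M ↦ F p.1 p.2))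

include hF in
omit [FiniteDimensional ℝ EM] [IM.Boundaryless] [IsManifold IM ∞ M] [FiniteDimensional ℝ EN]
  [CompleteSpace EN] [IsManifold IN ∞ N] in
/-- The two-parameter map `(t, s) ↦ F t (γ s)` of a `C^∞` family along a `C^∞` curve is `C^∞`.
[folklore] -/
theorem contMDiff_uncurry_comp_curve {γ : ℝ → M} (hγ : ContMDiff 𝓘(ℝ, ℝ) IM ∞ γ) :
    ContMDiff (𝓘(ℝ, ℝ).prod 𝓘(ℝ, ℝ)) IN ∞ (uncurry fun t s ↦ F t (γ s)) :=
  hF.comp (contMDiff_fst.prodMk (hγ.comp contMDiff_snd))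

include hF in
omit [FiniteDimensional ℝ EM] in
/-- **The second covariant time-derivative of the differential along a deformation**
(the commutation step of the second-variation formula; Eells–Lemaire 1983, (3.?) via O'Neill 1983,
Ch. 4, Prop. 44 (2) `Z_{ts} − Z_{st} = R(x_t, x_s) Z`): for a `C^∞` family `F : ℝ × M → N` into a
manifold with a `C^∞` metric `h` (Levi-Civita connection `∇`, curvature `R`), a point `x`,
`v ∈ T_x M` and a time `t₀`, with `V = ∂ₜF` the variation field and `a = D_t ∂ₜF` the
acceleration field,
`D_t D_t (dF_t(v)) (t₀) = D_v a(t₀, ·) + R(V, dF_{t₀} v) V` at `F t₀ x`,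
where `D_v a = h.normalDerivAlong (F t₀) a(t₀, ·) x v` is the induced derivative along `F t₀`.
Proof: along a globally smooth curve `γ` through `(x, v)`, for the two-parameter map
`P(t, s) = F t (γ s)` with `Z = P_t`: `D_t(dF_t v) = D_t P_s = D_s P_t`
(`covariantDerivAlong_mfderiv_stage`, torsion-freeness), hence
`D_t D_t (dF_t v) = D_t D_s Z = D_s D_t Z + R(P_t, P_s) Z`
(`covariantDerivAlong_covariantDerivAlong_sub_eq_curvature`), and `D_t Z = a ∘ P`.
[cite: ONeill1983, Ch. 4, Prop. 44 (2)] -/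
theorem covariantDerivAlong_covariantDerivAlong_mfderiv_stage (x : M) (v : TangentSpace IM x)
    (t₀ : ℝ) :
    covariantDerivAlong h.leviCivita (fun t ↦ F t x)
        (fun t ↦ covariantDerivAlong h.leviCivita (fun t' ↦ F t' x)
          (fun t' ↦ mfderiv IM IN (F t') x v) t) t₀ =
      h.normalDerivAlong (F t₀) (fun y ↦ covariantDerivAlong h.leviCivita (fun t' ↦ F t' y)
          (fun t' ↦ velocity IN (fun t ↦ F t y) t') t₀) x v +
        h.leviCivita.curvature (F t₀ x) (velocity IN (fun t ↦ F t x) t₀)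
          (mfderiv IM IN (F t₀) x v) (velocity IN (fun t ↦ F t x) t₀) := by
  have hcov1 : h.leviCivita.IsLocallyContMDiff 1 :=
    h.isLocallyContMDiff_leviCivita_holds 1 (by norm_cast)
  -- a global smooth curve through `(x, v)`
  obtain ⟨γ, hγs, hγc⟩ := exists_contMDiff_curve_eventuallyEq_curveThrough x v
  have hγ0 : γ 0 = x := by
    have := hγc.self_of_nhds
    rwa [curveThrough_zero] at this
  -- the two-parameter map `P (t, s) = F t (γ s)` and its `t`-velocity field `Z = P_t`
  have hPs : ContMDiff (𝓘(ℝ, ℝ).prod 𝓘(ℝ, ℝ)) IN ∞ (uncurry fun t s ↦ F t (γ s)) :=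
    contMDiff_uncurry_comp_curve hF hγs
  have hZs : ContMDiff (𝓘(ℝ, ℝ).prod 𝓘(ℝ, ℝ)) IN.tangent ∞
      (fun q : ℝ × ℝ ↦ (TotalSpace.mk' EN (F q.1 (γ q.2))
        (velocity IN (fun t' ↦ F t' (γ q.2)) q.1) : TangentBundle IN N)) :=
    contMDiff_lift_velocity_uncurry_left (x := fun t s ↦ F t (γ s)) hPs
  -- O'Neill 4.44 (2) at `(t₀, 0)`
  have hcurv := covariantDerivAlong_covariantDerivAlong_sub_eq_curvature (cov := h.leviCivita) hcov1
    (x := fun t s ↦ F t (γ s)) (Z := fun t s ↦ velocity IN (fun t' ↦ F t' (γ s)) t)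
    (t := t₀) (s := 0) ((hPs (t₀, 0)).of_le (by norm_cast)) ((hZs (t₀, 0)).of_le (by norm_cast))
  rw [hγ0] at hcurv
  -- ### identify the terms; first `D_s P_t (t', ·)|₀ = D_t (dF_t v) (t')` for every `t'`
  have hinner : ∀ t', (covariantDerivAlong h.leviCivita (fun s ↦ F t' (γ s))
      (fun s ↦ velocity IN (fun t ↦ F t (γ s)) t') 0 : EN) =
      covariantDerivAlong h.leviCivita (fun t ↦ F t x) (fun t ↦ mfderiv IM IN (F t) x v) t' := by
    intro t'
    rw [covariantDerivAlong_mfderiv_stage h hF x v t', PseudoRiemannianMetric.normalDerivAlong]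
    refine covariantDerivAlong_congr_of_eventuallyEq (cov := h.leviCivita) ?_
    filter_upwards [hγc] with s hs
    simp only [Function.comp_apply]
    rw [hs]
  have hterm1 : (covariantDerivAlong h.leviCivita (fun t' ↦ F t' x)
      (fun t' ↦ covariantDerivAlong h.leviCivita (fun s ↦ F t' (γ s))
        (fun s ↦ velocity IN (fun t ↦ F t (γ s)) t') 0) t₀ : EN) =
      covariantDerivAlong h.leviCivita (fun t ↦ F t x)
        (fun t ↦ covariantDerivAlong h.leviCivita (fun t' ↦ F t' x)
          (fun t' ↦ mfderiv IM IN (F t') x v) t) t₀ := by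
    refine covariantDerivAlong_congr_lift h ?_ t₀
    funext t'
    congr 1
    exact hinner t'
  -- second: `D_t P_t (t₀, s) = a(t₀, γ s)`, so its `D_s` at `0` is `D_v a(t₀, ·)`
  have hterm2 : (covariantDerivAlong h.leviCivita (fun s ↦ F t₀ (γ s))
      (fun s' ↦ covariantDerivAlong h.leviCivita (fun t' ↦ F t' (γ s'))
        (fun t' ↦ velocity IN (fun t ↦ F t (γ s')) t') t₀) 0 : EN) =
      h.normalDerivAlong (F t₀) (fun y ↦ covariantDerivAlong h.leviCivita (fun t' ↦ F t' y)
          (fun t' ↦ velocity IN (fun t ↦ F t y) t') t₀) x v := by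
    rw [PseudoRiemannianMetric.normalDerivAlong]
    refine covariantDerivAlong_congr_of_eventuallyEq (cov := h.leviCivita) ?_
    filter_upwards [hγc] with s hs
    simp only [Function.comp_apply]
    rw [hs]
  -- the `s`-velocity of `P` at `(t₀, 0)` is `dF_{t₀}(v)`
  have hvs : (velocity IN (fun s ↦ F t₀ (γ s)) 0 : EN) = mfderiv IM IN (F t₀) x v := by
    have h1 : (velocity IN (fun s ↦ F t₀ (γ s)) 0 : EN) =
        velocity IN (fun s ↦ F t₀ (curveThrough IM x v s)) 0 := by
      simp only [velocity]
      exact DFunLike.congr_fun (hγc.fun_comp (F t₀)).mfderiv_eq 1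
    rw [h1]
    exact velocity_stage_comp_curveThrough hF x v t₀
  -- assemble
  rw [hterm1, hterm2, hvs] at hcurv
  exact eq_add_of_sub_eq' hcurv

/-! ### Smooth lifts of `dF_t(v)` and of its covariant time-derivatives -/

include hF in
omit [FiniteDimensional ℝ EM] [FiniteDimensional ℝ EN] [CompleteSpace EN] [h.HasLeviCivita] in
/-- **`t ↦ (F t x, dF_t(v)) ∈ TN` is `C^∞`**: along a globally smooth curve `γ` through `(x, v)`
it is the lift of the `s`-velocity of `(t, s) ↦ F t (γ s)` at `s = 0`
(`contMDiff_lift_velocity_curry_right`). O'Neill 1983, Ch. 4, p. 122.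
[cite: ONeill1983, Ch. 4, p. 122] -/
theorem contMDiff_lift_mfderiv_stage (x : M) (v : TangentSpace IM x) :
    ContMDiff 𝓘(ℝ, ℝ) IN.tangent ∞
      (fun t ↦ (TotalSpace.mk' EN (F t x) (mfderiv IM IN (F t) x v) : TangentBundle IN N)) := by
  obtain ⟨γ, hγs, hγc⟩ := exists_contMDiff_curve_eventuallyEq_curveThrough x v
  have hγ0 : γ 0 = x := by
    have := hγc.self_of_nhds
    rwa [curveThrough_zero] at this
  have hγv : (velocity IM γ 0 : EM) = v := by
    have h1 : (velocity IM γ 0 : EM) = velocity IM (curveThrough IM x v) 0 := by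
      simp only [velocity]
      exact DFunLike.congr_fun hγc.mfderiv_eq 1
    rw [h1]
    exact velocity_curveThrough_zero_holds BoundarylessManifold.isInteriorPoint v
  have hl := contMDiff_lift_velocity_curry_right (x := fun t s ↦ F t (γ s))
    (contMDiff_uncurry_comp_curve hF hγs) 0
  have heq : (fun t ↦ (TotalSpace.mk' EN ((fun t s ↦ F t (γ s)) t 0)
      (velocity IN ((fun t s ↦ F t (γ s)) t) 0) : TangentBundle IN N)) =
      fun t ↦ (TotalSpace.mk' EN (F t x) (mfderiv IM IN (F t) x v) : TangentBundle IN N) := by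
    funext t
    have hFt : MDifferentiableAt IM IN (F t) (γ 0) := (contMDiff_stage hF t (γ 0)).mdifferentiableAt (by simp)
    have hγd : MDifferentiableAt 𝓘(ℝ, ℝ) IM γ 0 := (hγs 0).mdifferentiableAt (by simp)
    have hvel : (velocity IN (fun s ↦ F t (γ s)) 0 : EN) = mfderiv IM IN (F t) (γ 0) (velocity IM γ 0) := by
      simp only [velocity]
      rw [show (fun s ↦ F t (γ s)) = F t ∘ γ from rfl, mfderiv_comp 0 hFt hγd]
      rfl
    simp only [hvel, hγv]
    rw [hγ0]
  rwa [heq] at hl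

include hF in
omit [FiniteDimensional ℝ EM] [CompleteSpace EN] in
/-- **`t ↦ (F t x, D_t (dF_t v)) ∈ TN` is `C^∞`** (`contMDiff_lift_covariantDerivAlong_of_lift`
for the smooth lift `contMDiff_lift_mfderiv_stage` and the `C^∞` Levi-Civita connection).
[cite: ONeill1983, Ch. 4, p. 123] -/
theorem contMDiff_lift_covariantDerivAlong_mfderiv_stage (x : M) (v : TangentSpace IM x) :
    ContMDiff 𝓘(ℝ, ℝ) IN.tangent ∞
      (fun t ↦ (TotalSpace.mk' EN (F t x) (covariantDerivAlong h.leviCivita (fun t' ↦ F t' x)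
        (fun t' ↦ mfderiv IM IN (F t') x v) t) : TangentBundle IN N)) := by
  have hcov : h.leviCivita.IsLocallyContMDiff (⊤ : ℕ∞) :=
    h.isLocallyContMDiff_leviCivita_holds ⊤ (by simp)
  exact contMDiff_lift_covariantDerivAlong_of_lift hcov (contMDiff_lift_mfderiv_stage hF x v)

include hF in
omit [FiniteDimensional ℝ EM] in
/-- **The second time-derivative of a coefficient `h(dF_t v, dF_t w)` along a deformation**
(the pointwise core of the second-variation formula of the energy): with `V = ∂ₜF(t₀, ·)` the
variation field, `a = D_t∂ₜF(t₀, ·)` the acceleration field, `D_v` the induced derivative along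
`F t₀` (`normalDerivAlong`) and `R` the curvature of `h`, the function
`t ↦ h(D_t dF_t v, dF_t w) + h(dF_t v, D_t dF_t w)` — the first derivative of
`t ↦ h(dF_t v, dF_t w)` (`hasDerivAt_val_mfderiv_stage`) — has derivative at `t₀`
`h(D_v a + R(V, dF v)V, dF w) + 2 h(D_v V, D_w V) + h(dF v, D_w a + R(V, dF w)V)`
(product rule along `t ↦ F t x`, `hasDerivAt_val_apply_along`, and
`covariantDerivAlong_covariantDerivAlong_mfderiv_stage`). Eells–Lemaire 1983, §3 (second
variation); O'Neill 1983, Ch. 4, Prop. 44 (2) and Ch. 10, Thm. 10.4 (for curves).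
[cite: ONeill1983, Ch. 4, Prop. 44 (2)] -/
theorem hasDerivAt_deriv_val_mfderiv_stage (x : M) (v w : TangentSpace IM x) (t₀ : ℝ) :
    HasDerivAt (fun t ↦
        h.val (F t x) (covariantDerivAlong h.leviCivita (fun t' ↦ F t' x)
            (fun t' ↦ mfderiv IM IN (F t') x v) t) (mfderiv IM IN (F t) x w) +
          h.val (F t x) (mfderiv IM IN (F t) x v) (covariantDerivAlong h.leviCivita
            (fun t' ↦ F t' x) (fun t' ↦ mfderiv IM IN (F t') x w) t))
      (h.val (F t₀ x)
          (h.normalDerivAlong (F t₀) (fun y ↦ covariantDerivAlong h.leviCivita (fun t' ↦ F t' y)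
              (fun t' ↦ velocity IN (fun t ↦ F t y) t') t₀) x v +
            h.leviCivita.curvature (F t₀ x) (velocity IN (fun t ↦ F t x) t₀)
              (mfderiv IM IN (F t₀) x v) (velocity IN (fun t ↦ F t x) t₀))
          (mfderiv IM IN (F t₀) x w) +
        2 * h.val (F t₀ x) (h.normalDerivAlong (F t₀) (fun y ↦ velocity IN (fun t ↦ F t y) t₀) x v)
          (h.normalDerivAlong (F t₀) (fun y ↦ velocity IN (fun t ↦ F t y) t₀) x w) +
        h.val (F t₀ x) (mfderiv IM IN (F t₀) x v)
          (h.normalDerivAlong (F t₀) (fun y ↦ covariantDerivAlong h.leviCivita (fun t' ↦ F t' y)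
              (fun t' ↦ velocity IN (fun t ↦ F t y) t') t₀) x w +
            h.leviCivita.curvature (F t₀ x) (velocity IN (fun t ↦ F t x) t₀)
              (mfderiv IM IN (F t₀) x w) (velocity IN (fun t ↦ F t x) t₀))) t₀ := by
  have hcompat : h.IsCompatible h.leviCivita := (isLeviCivita_leviCivita_holds (g := h)).2
  have hA : ∀ u : TangentSpace IM x, MDifferentiableAt 𝓘(ℝ, ℝ) IN.tangent
      (fun t ↦ (TotalSpace.mk' EN (F t x) (mfderiv IM IN (F t) x u) : TangentBundle IN N)) t₀ :=
    fun u ↦ (contMDiff_lift_mfderiv_stage hF x u t₀).mdifferentiableAt (by simp)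
  have hDA : ∀ u : TangentSpace IM x, MDifferentiableAt 𝓘(ℝ, ℝ) IN.tangent
      (fun t ↦ (TotalSpace.mk' EN (F t x) (covariantDerivAlong h.leviCivita (fun t' ↦ F t' x)
        (fun t' ↦ mfderiv IM IN (F t') x u) t) : TangentBundle IN N)) t₀ :=
    fun u ↦ (contMDiff_lift_covariantDerivAlong_mfderiv_stage h hF x u t₀).mdifferentiableAt (by simp)
  have h1 := hasDerivAt_val_apply_along (g := h) hcompat (hDA v) (hA w)
  have h2 := hasDerivAt_val_apply_along (g := h) hcompat (hA v) (hDA w)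
  have h12 : HasDerivAt (fun t ↦
      h.val (F t x) (covariantDerivAlong h.leviCivita (fun t' ↦ F t' x)
          (fun t' ↦ mfderiv IM IN (F t') x v) t) (mfderiv IM IN (F t) x w) +
        h.val (F t x) (mfderiv IM IN (F t) x v) (covariantDerivAlong h.leviCivita
          (fun t' ↦ F t' x) (fun t' ↦ mfderiv IM IN (F t') x w) t)) _ t₀ := h1.add h2
  rw [covariantDerivAlong_covariantDerivAlong_mfderiv_stage h hF x v t₀,
    covariantDerivAlong_covariantDerivAlong_mfderiv_stage h hF x w t₀,
    covariantDerivAlong_mfderiv_stage h hF x v t₀, covariantDerivAlong_mfderiv_stage h hF x w t₀] at h12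
  refine h12.congr_deriv ?_
  ring

/-! ### The second time-derivative of the energy density -/

variable (g : ContMDiffRiemannianMetric IM ∞ EM (TangentSpace IM : M → Type _))

include hF in
/-- **The second time-derivative of the energy density along a deformation, pointwise**
(Eells–Lemaire 1983, §3; the integrand of the second-variation formula before integration by
parts): in the canonical frame `sᵢ` of `T_x M` with inverse Gram matrix `𝒢⁻¹`,
`d²/dt²|_{t₀} e(F_t)(x) = ½ ∑ᵢⱼ (𝒢⁻¹)ⱼᵢ Φᵢⱼ` where `Φᵢⱼ` is the second derivative of
`h(dF_t sᵢ, dF_t sⱼ)` computed by `hasDerivAt_deriv_val_mfderiv_stage`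
(`h(D_{sᵢ} a + R(V, dF sᵢ)V, dF sⱼ) + 2 h(D_{sᵢ}V, D_{sⱼ}V) + h(dF sᵢ, D_{sⱼ} a + R(V, dF sⱼ)V)`).
Stated for the derivative function `t ↦ d/dt e(F_t)(x)`. [cite: ONeill1983, Ch. 4, Prop. 44 (2)]
[cite: EellsRatto1993, Ch. I (1.9), proof, Step 1] -/
theorem hasDerivAt_deriv_energyDensity_stage (x : M) (t₀ : ℝ) :
    HasDerivAt (fun t ↦ deriv (fun s ↦ energyDensity g h (F s) x) t)
      ((1 / 2 : ℝ) * ∑ i, ∑ j,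
        (Matrix.of fun i j ↦ (ofRiemannian g).val x
            ((trivializationAt EM (TangentSpace IM : M → Type _) x).localFrame
              (Module.finBasis ℝ EM) i x)
            ((trivializationAt EM (TangentSpace IM : M → Type _) x).localFrame
              (Module.finBasis ℝ EM) j x))⁻¹ j i *
          (h.val (F t₀ x)
              (h.normalDerivAlong (F t₀) (fun y ↦ covariantDerivAlong h.leviCivita
                  (fun t' ↦ F t' y) (fun t' ↦ velocity IN (fun t ↦ F t y) t') t₀) x
                  ((trivializationAt EM (TangentSpace IM : M → Type _) x).localFrame
                    (Module.finBasis ℝ EM) i x) +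
                h.leviCivita.curvature (F t₀ x) (velocity IN (fun t ↦ F t x) t₀)
                  (mfderiv IM IN (F t₀) x ((trivializationAt EM (TangentSpace IM : M → Type _)
                    x).localFrame (Module.finBasis ℝ EM) i x)) (velocity IN (fun t ↦ F t x) t₀))
              (mfderiv IM IN (F t₀) x ((trivializationAt EM (TangentSpace IM : M → Type _)
                x).localFrame (Module.finBasis ℝ EM) j x)) +
            2 * h.val (F t₀ x)
              (h.normalDerivAlong (F t₀) (fun y ↦ velocity IN (fun t ↦ F t y) t₀) x
                ((trivializationAt EM (TangentSpace IM : M → Type _) x).localFrame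
                  (Module.finBasis ℝ EM) i x))
              (h.normalDerivAlong (F t₀) (fun y ↦ velocity IN (fun t ↦ F t y) t₀) x
                ((trivializationAt EM (TangentSpace IM : M → Type _) x).localFrame
                  (Module.finBasis ℝ EM) j x)) +
            h.val (F t₀ x)
              (mfderiv IM IN (F t₀) x ((trivializationAt EM (TangentSpace IM : M → Type _)
                x).localFrame (Module.finBasis ℝ EM) i x))
              (h.normalDerivAlong (F t₀) (fun y ↦ covariantDerivAlong h.leviCivita
                  (fun t' ↦ F t' y) (fun t' ↦ velocity IN (fun t ↦ F t y) t') t₀) x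
                  ((trivializationAt EM (TangentSpace IM : M → Type _) x).localFrame
                    (Module.finBasis ℝ EM) j x) +
                h.leviCivita.curvature (F t₀ x) (velocity IN (fun t ↦ F t x) t₀)
                  (mfderiv IM IN (F t₀) x ((trivializationAt EM (TangentSpace IM : M → Type _)
                    x).localFrame (Module.finBasis ℝ EM) j x)) (velocity IN (fun t ↦ F t x) t₀))))
      t₀ := by
  classical
  have hcompat : h.IsCompatible h.leviCivita := (isLeviCivita_leviCivita_holds (g := h)).2
  set s := fun i ↦ (trivializationAt EM (TangentSpace IM : M → Type _) x).localFrame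
    (Module.finBasis ℝ EM) i x with hs
  set Ginv := (Matrix.of fun i j ↦ (ofRiemannian g).val x
      ((trivializationAt EM (TangentSpace IM : M → Type _) x).localFrame (Module.finBasis ℝ EM) i x)
      ((trivializationAt EM (TangentSpace IM : M → Type _) x).localFrame (Module.finBasis ℝ EM) j x))⁻¹
    with hGinv
  -- the first derivative, at every time, in `D_t dF_t` form
  have hA : ∀ (u : TangentSpace IM x) (t : ℝ), MDifferentiableAt 𝓘(ℝ, ℝ) IN.tangent
      (fun t ↦ (TotalSpace.mk' EN (F t x) (mfderiv IM IN (F t) x u) : TangentBundle IN N)) t :=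
    fun u t ↦ (contMDiff_lift_mfderiv_stage hF x u t).mdifferentiableAt (by simp)
  have hfirst : ∀ t, HasDerivAt (fun s' ↦ energyDensity g h (F s') x)
      ((1 / 2 : ℝ) * ∑ i, ∑ j, Ginv j i *
        (h.val (F t x) (covariantDerivAlong h.leviCivita (fun t' ↦ F t' x)
            (fun t' ↦ mfderiv IM IN (F t') x (s i)) t) (mfderiv IM IN (F t) x (s j)) +
          h.val (F t x) (mfderiv IM IN (F t) x (s i)) (covariantDerivAlong h.leviCivita
            (fun t' ↦ F t' x) (fun t' ↦ mfderiv IM IN (F t') x (s j)) t))) t := by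
    intro t
    have hfun : (fun s' ↦ energyDensity g h (F s') x) = fun s' ↦ (1 / 2 : ℝ) * ∑ i, ∑ j,
        Ginv j i * h.val (F s' x) (mfderiv IM IN (F s') x (s i)) (mfderiv IM IN (F s') x (s j)) := by
      funext s'
      exact energyDensity_eq_sum_frame h g (F s') x
    rw [hfun]
    refine HasDerivAt.const_mul _ (HasDerivAt.fun_sum fun i _ ↦ HasDerivAt.fun_sum fun j _ ↦ ?_)
    exact (hasDerivAt_val_apply_along (g := h) hcompat (hA (s i) t) (hA (s j) t)).const_mul _
  have hderiv : (fun t ↦ deriv (fun s' ↦ energyDensity g h (F s') x) t) = fun t ↦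
      (1 / 2 : ℝ) * ∑ i, ∑ j, Ginv j i *
        (h.val (F t x) (covariantDerivAlong h.leviCivita (fun t' ↦ F t' x)
            (fun t' ↦ mfderiv IM IN (F t') x (s i)) t) (mfderiv IM IN (F t) x (s j)) +
          h.val (F t x) (mfderiv IM IN (F t) x (s i)) (covariantDerivAlong h.leviCivita
            (fun t' ↦ F t' x) (fun t' ↦ mfderiv IM IN (F t') x (s j)) t)) :=
    funext fun t ↦ (hfirst t).deriv
  rw [hderiv]
  -- differentiate once more, term by term
  refine HasDerivAt.const_mul _ (HasDerivAt.fun_sum fun i _ ↦ HasDerivAt.fun_sum fun j _ ↦ ?_)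
  exact (hasDerivAt_deriv_val_mfderiv_stage h hF x (s i) (s j) t₀).const_mul _

end HarmonicMap

end Literature.Geometry.Riemannian

end
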